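import Mathlib.Data.Rat.Defs
import Mathlib.Data.Fintype.Basic
import Mathlib.Tactic.Linarith
import Mathlib.Tactic.NormNum
import Mathlib.Tactic.FinCases
import Mathlib.Tactic.Ring
import Mathlib.Data.Fin.VecNotation
import HarnessLib

/-!
# Volkov PRD 109, 036012 (2024) §III: the printed «vector of divergences» [v₀,…,v_n; w₀,…,w_n] of the infrared power counting — its admissible region is a SEGMENT: with E := 2v_j − w_j (the printed common value), every printed constraint is equivalent to w_j = 2v_j − E with E/2 ≤ v_j ≤ E, and the printed «there exists j such that w_j = 0» is «min_j v_j = E/2»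

independent recomputation; certified where stated, statistical where stated; no new-physics claim.

CITATION HEADER (venture `QEDPrecision`, cell `pub-qed`, track TROPICAL seat V3b = `pub-qed-trop-v3-lit-2` gen 6; VALUE-FREE: the printed
DEFINITION of the candidate IR-divergent scalings only — no integral, no graph of the cell, nothing per word). Serves `tropical/view/V3-VOLKOV-DEGREES.md`
§B B.4 («THE GENERAL IR POWER COUNTING IS TWO-SCALE») / B.7 fact (i) / B.17 clause 4, and V3a's §A A.14–A.15 (the ЖЭТФ 149 App. C originals of the same
vectors, instantiated there as 525 chart-V rays): the exact shape of Volkov's own list of dangerous directions, which a one-scale ray census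
under-samples.

Source. [Volkov2024PRD109] S. Volkov, "Calculation of lepton magnetic moments in quantum electrodynamics: a justification of the flexible
divergence elimination method", Phys. Rev. D 109, 036012 (2024) = arXiv:2308.11560v4, §III (arXiv PDF p.10; e-print tex
`method_details_2023.tex` l.428–438, held by the cell under `data/lit/sources/.cache/2308.11560/`), VERBATIM: "With the help of power counting,
we investigate the case z_l ≍ δ^{β_l}, δ → 0, where β_l ≥ 0 are some numbers corresponding to the internal lines. By P_j we denote the set of
all lines l on the main path of G such that l ∈ G_{j+1} and l ∉ G_j. … If all divergences not belonging to 𝕴[G] are properly subtracted, a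
potentially IR divergent case corresponds to a vector of divergences [v₀,…,v_n; w₀,…,w_n], where v_j ≥ w_j ≥ 0,
2v₀ − w₀ = 2v₁ − w₁ = … = 2v_n − w_n > 0, there exists j such that w_j = 0. This vector gives the values β_l = v_j, if l ∈ P_j; w_j, if
l ∈ G_{j+1}, l ∉ G_j, l ∉ P_j." (Here G₁ ⊂ … ⊂ G_n ⊂ G_{n+1} = G are the elements of 𝕴[G], "Following [ЖЭТФ 149 (2016)], Appendix C"; the
original vectors are that paper's (45)–(47), the cell's `irse/lit/VOLKOV-IR-EXTRACT-lit.md` §7.4.)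

The model. A divergence vector with n+1 layers is a pair of functions v, w : Fin (n+1) → ℚ with the three printed constraints; E denotes the
printed common value 2v_j − w_j (we carry it as a field with its defining property, which is equivalent). What is deliberately NOT here: the
graphs G_j, the sets P_j, the map l ↦ β_l (it is the displayed case split, a bookkeeping of which layer a line belongs to), and anything
about whether a given vector actually produces a divergence of a given forest term (the paper: "This argument shows how it works, but a full
rigorous examination seems difficult and cumbersome; we rely on a numerical check", p.10).

What the kernel certifies (linear arithmetic over ℚ on the printed constraints):
* `DivVector` — the printed definition; `E_pos`, `w_eq` (w_j = 2v_j − E: the off-path exponent of a layer is an affine function of its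
  on-path exponent), `v_le_E` (⇔ the printed v_j ≥ w_j), `half_E_le_v` (⇔ the printed w_j ≥ 0), `w_nonneg'`, `w_le_E`, `w_le_v'`,
  `w_eq_zero_iff` (w_j = 0 ⇔ v_j = E/2), `w_eq_v_iff` (w_j = v_j ⇔ v_j = E ⇔ w_j = E: the layer is ONE-scale), `exists_v_eq_half` (the printed
  "there exists j such that w_j = 0" ⇔ some layer sits at the LOWER end v_j = E/2 with its off-path lines FIXED, β = 0);
* `mk'` — conversely, ANY v : Fin (n+1) → ℚ with E/2 ≤ v_j ≤ E for all j and v_j = E/2 for some j defines a divergence vector with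
  w := 2v − E: the admissible region is exactly the cube [E/2, E]^{n+1} with one coordinate pinned to E/2 (a union of n+1 faces), and
  nothing else is constrained by the print;
* `twoScale_of_extreme` — at the cube's vertices (every v_j ∈ {E/2, E}) every exponent β lies in {0, E/2, E}: with the normalisation
  E = 2 these are the (leptons ∈ {1, 2} | photons ∈ {0, 2}) vectors of ЖЭТФ 149 App. C that V3a tabled (`V3-V16RAYS-o10.tsv`), `normalised_range`
  (E = 2 ⇒ 1 ≤ v_j ≤ 2 and w_j = 2v_j − 2 ∈ [0, 2]);
* `example_two_layers` — the model is inhabited: n = 1, E = 2, v = (1, 2), w = (0, 2) (the δ / δ² pattern of NPB 961 §1's remark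
  "sometimes a substitution of the form z_{j₁} = … = δ, z_{j_{l+1}} = … = δ² is required").
-/

namespace Literature.MathematicalPhysics.QuantumFieldTheory.Volkov2024PRD109

/-- The printed «vector of divergences» [v₀,…,v_n; w₀,…,w_n]: "v_j ≥ w_j ≥ 0, 2v₀ − w₀ = 2v₁ − w₁ = … = 2v_n − w_n > 0, there exists j such that
w_j = 0"; the common value is carried as the field `E` with its defining equation. [cite: Volkov2024PRD109, §III (arXiv p.10; tex l.435)] -/
structure DivVector (n : ℕ) where
  /-- on-path exponents: β_l = v_j for l ∈ P_j -/
  v : Fin (n + 1) → ℚ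
  /-- off-path exponents: β_l = w_j for the other lines of layer j -/
  w : Fin (n + 1) → ℚ
  /-- the printed common value 2v_j − w_j -/
  E : ℚ
  /-- "2v₀ − w₀ = 2v₁ − w₁ = … = 2v_n − w_n" -/
  common : ∀ j, 2 * v j - w j = E
  /-- "… > 0" -/
  E_pos : 0 < E
  /-- "v_j ≥ w_j" -/
  w_le_v : ∀ j, w j ≤ v j
  /-- "w_j ≥ 0" -/
  w_nonneg : ∀ j, 0 ≤ w j
  /-- "there exists j such that w_j = 0" -/
  exists_w_zero : ∃ j, w j = 0

namespace DivVector

section Consequences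

variable {n : ℕ} (D : DivVector n)

/-- The off-path exponent of every layer is affine in the on-path one: w_j = 2v_j − E. [cite: Volkov2024PRD109, §III (arXiv p.10)] -/
theorem w_eq (j : Fin (n + 1)) : D.w j = 2 * D.v j - D.E := by
  have h := D.common j; linarith

/-- The printed "v_j ≥ w_j" is equivalent to v_j ≤ E. [cite: Volkov2024PRD109, §III (arXiv p.10)] -/
theorem v_le_E (j : Fin (n + 1)) : D.v j ≤ D.E := by
  have h1 := D.w_eq j; have h2 := D.w_le_v j; linarith

/-- The printed "w_j ≥ 0" is equivalent to E/2 ≤ v_j: every on-path exponent is at least HALF the common value. [cite: Volkov2024PRD109, §III (arXiv p.10)] -/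
theorem half_E_le_v (j : Fin (n + 1)) : D.E / 2 ≤ D.v j := by
  have h1 := D.w_eq j; have h2 := D.w_nonneg j; linarith

/-- Every on-path exponent is positive (≥ E/2 > 0): no main-path line of any layer stays fixed. [cite: Volkov2024PRD109, §III (arXiv p.10)] -/
theorem v_pos (j : Fin (n + 1)) : 0 < D.v j := by
  have h1 := D.half_E_le_v j; have h2 := D.E_pos; linarith

/-- Off-path exponents lie in [0, E]. [cite: Volkov2024PRD109, §III (arXiv p.10)] -/
theorem w_le_E (j : Fin (n + 1)) : D.w j ≤ D.E := by
  have h1 := D.w_eq j; have h2 := D.v_le_E j; linarith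

/-- w_j = 0 ⇔ v_j = E/2: a layer whose off-path lines stay FIXED is exactly a layer at the lower end of the segment.
[cite: Volkov2024PRD109, §III (arXiv p.10)] -/
theorem w_eq_zero_iff (j : Fin (n + 1)) : D.w j = 0 ↔ D.v j = D.E / 2 := by
  have h1 := D.w_eq j
  constructor <;> intro h <;> linarith

/-- w_j = v_j ⇔ v_j = E: a ONE-scale layer (all its lines at the same power) is exactly a layer at the upper end.
[cite: Volkov2024PRD109, §III (arXiv p.10)] -/
theorem w_eq_v_iff (j : Fin (n + 1)) : D.w j = D.v j ↔ D.v j = D.E := by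
  have h1 := D.w_eq j
  constructor <;> intro h <;> linarith

/-- … equivalently w_j = E. [cite: Volkov2024PRD109, §III (arXiv p.10)] -/
theorem w_eq_E_iff (j : Fin (n + 1)) : D.w j = D.E ↔ D.v j = D.E := by
  have h1 := D.w_eq j
  constructor <;> intro h <;> linarith

/-- The printed "there exists j such that w_j = 0" says: the minimum of the on-path exponents is E/2, attained. [cite: Volkov2024PRD109, §III (arXiv p.10)] -/
theorem exists_v_eq_half : ∃ j, D.v j = D.E / 2 := by
  obtain ⟨j, hj⟩ := D.exists_w_zero
  exact ⟨j, (D.w_eq_zero_iff j).1 hj⟩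

/-- Strict two-scale separation inside a layer away from the upper end: w_j < v_j ⇔ v_j < E. [cite: Volkov2024PRD109, §III (arXiv p.10)] -/
theorem w_lt_v_iff (j : Fin (n + 1)) : D.w j < D.v j ↔ D.v j < D.E := by
  have h1 := D.w_eq j
  constructor <;> intro h <;> linarith

end Consequences

/-- CONVERSELY: any on-path profile v with E/2 ≤ v_j ≤ E for all j and v_j = E/2 for some j IS a printed divergence vector, with w := 2v − E —
the admissible region is exactly the cube [E/2, E]^{n+1} with (at least) one coordinate pinned to E/2; the print constrains nothing else.
[cite: Volkov2024PRD109, §III (arXiv p.10)] -/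
def mk' {n : ℕ} (E : ℚ) (hE : 0 < E) (v : Fin (n + 1) → ℚ) (hlo : ∀ j, E / 2 ≤ v j) (hhi : ∀ j, v j ≤ E) (hmin : ∃ j, v j = E / 2) :
    DivVector n where
  v := v
  w := fun j => 2 * v j - E
  E := E
  common := fun j => by ring
  E_pos := hE
  w_le_v := fun j => by have := hhi j; linarith
  w_nonneg := fun j => by have := hlo j; linarith
  exists_w_zero := by obtain ⟨j, hj⟩ := hmin; exact ⟨j, by rw [hj]; ring⟩

/-- `mk'` returns the given profile. [cite: Volkov2024PRD109, §III (arXiv p.10)] -/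
theorem mk'_v {n : ℕ} (E : ℚ) (hE : 0 < E) (v : Fin (n + 1) → ℚ) (hlo : ∀ j, E / 2 ≤ v j) (hhi : ∀ j, v j ≤ E) (hmin : ∃ j, v j = E / 2) :
    (mk' E hE v hlo hhi hmin).v = v ∧ (mk' E hE v hlo hhi hmin).E = E := ⟨rfl, rfl⟩

section Extremes

variable {n : ℕ} (D : DivVector n)

/-- At the VERTICES of the admissible cube (every v_j ∈ {E/2, E}) every exponent of the vector lies in {0, E/2, E}: v_j ∈ {E/2, E} and
w_j ∈ {0, E} — with E = 2 these are the (path lines ∈ {1, 2} | other lines ∈ {0, 2}) vectors of ЖЭТФ 149 App. C (V3a's 525-ray registry).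
[cite: Volkov2024PRD109, §III (arXiv p.10)] -/
theorem twoScale_of_extreme (h : ∀ j, D.v j = D.E / 2 ∨ D.v j = D.E) (j : Fin (n + 1)) :
    (D.v j = D.E / 2 ∧ D.w j = 0) ∨ (D.v j = D.E ∧ D.w j = D.E) := by
  rcases h j with hj | hj
  · exact Or.inl ⟨hj, (D.w_eq_zero_iff j).2 hj⟩
  · exact Or.inr ⟨hj, (D.w_eq_E_iff j).2 hj⟩

/-- With the normalisation E = 2 (a rescaling of δ): 1 ≤ v_j ≤ 2 and w_j = 2v_j − 2 ∈ [0, 2] for every layer, and some layer has v_j = 1, w_j = 0.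
[cite: Volkov2024PRD109, §III (arXiv p.10)] -/
theorem normalised_range (hE : D.E = 2) (j : Fin (n + 1)) :
    1 ≤ D.v j ∧ D.v j ≤ 2 ∧ D.w j = 2 * D.v j - 2 ∧ 0 ≤ D.w j ∧ D.w j ≤ 2 := by
  have h1 := D.half_E_le_v j; have h2 := D.v_le_E j; have h3 := D.w_eq j; have h4 := D.w_nonneg j; have h5 := D.w_le_E j
  rw [hE] at h1 h2 h3 h5
  refine ⟨by linarith, h2, h3, h4, h5⟩

end Extremes

end DivVector

/-- The model is inhabited by the basic two-layer pattern: n = 1, E = 2, v = (1, 2), w = (0, 2) — layer 0 at (path δ¹, others fixed), layer 1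
one-scale at δ² (NPB 961 §1: "sometimes a substitution of the form z_{j₁} = … = z_{j_l} = δ, z_{j_{l+1}} = … = z_{j_q} = δ² is required").
[cite: Volkov2024PRD109, §III (arXiv p.10)] -/
def exampleTwoLayers : DivVector 1 where
  v := ![1, 2]
  w := ![0, 2]
  E := 2
  common := by intro j; fin_cases j <;> norm_num
  E_pos := by norm_num
  w_le_v := by intro j; fin_cases j <;> simp
  w_nonneg := by intro j; fin_cases j <;> simp
  exists_w_zero := ⟨0, by simp⟩

/-- In the example, layer 0 is the pinned (two-scale) layer and layer 1 the one-scale layer. [cite: Volkov2024PRD109, §III (arXiv p.10)] -/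
theorem exampleTwoLayers_layers :
    exampleTwoLayers.v 0 = exampleTwoLayers.E / 2 ∧ exampleTwoLayers.w 1 = exampleTwoLayers.v 1 := by
  norm_num [exampleTwoLayers]

end Literature.MathematicalPhysics.QuantumFieldTheory.Volkov2024PRD109
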